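import Mathlib.AlgebraicGeometry.Morphisms.Flat
import Mathlib.RingTheory.Flat.Basic
import HarnessLib

/-!
# A retract of a flat `S`-scheme is flat

Topic `Literature/AlgebraicGeometry/Morphisms`; namespace `Literature.AlgebraicGeometry.Morphisms`.  THEOREMS ONLY (no definition, no
named fact, no instance, no notation, no `sorry`).  Cell `hodgecm-mathlib` (D-0151), FLOOR 0, P6 «MOD programme» generic organ (n4)(i)
of the P6b desk's Row 4 (input of the idempotent splitting of finite flat group schemes, `stub_L42`); `--supports stmt-HodgeConjecture-24832`;
COUNT-NEUTRAL: HC_CM is proved only modulo the 7 printed citations until rung 0 closes; this file discharges none of them.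

THE PRINT.  «A direct sum of modules is flat iff each summand is flat» ([AtiyahMacdonald1969] Ch. 2 Exercise 4; Mathlib
`Module.Flat.of_retract`); flatness of a morphism of schemes is flatness of all local ring maps (Mathlib `Flat.iff_flat_stalkMap`).

WHAT IS HERE:
* §1 `ringHom_flat_of_retract` — `θ : R → A`, `ψ : R → B` flat, `b : A → B` over `R` (`b ∘ θ = ψ`), `ρ : B → A` with `ρ ∘ b` BIJECTIVE
  ⇒ `θ` flat (ring-hom currency of `Module.Flat.of_retract`, up to an automorphism of the retract);
* §2 **`flat_of_retract`** — `pX : X → S`, `pY : Y → S`, `r : Y → X` over `S` with a section `j : X → Y` (`j ≫ r = 𝟙 X`), `pY` flat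
  ⇒ `pX` flat (stalkwise: `𝒪_{X,x}` is a retract of `𝒪_{Y,j x}` over `𝒪_{S,s}` via `r^*`, `j^*`, the identifications of stalks along
  `r (j x) = x` and `pY (j x) = pX (r (j x))` being Mathlib `Scheme.Hom.stalkMap_congr_hom`).

NOT HERE: finiteness of a retract (immediate when the section is a closed immersion: `pX = j ≫ pY`), faithful flatness.

## References
* [AtiyahMacdonald1969] M. F. Atiyah, I. G. Macdonald, *Introduction to Commutative Algebra* (1969) — Ch. 2, Exercise 4 (p. 31).
-/

noncomputable section

universe u

open CategoryTheory CategoryTheory.Limits AlgebraicGeometry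

namespace Literature.AlgebraicGeometry.Morphisms

/-! ## §1 Algebra: a ring retract (up to an automorphism) of a flat algebra is flat -/

/-- **A retract of a flat algebra is flat** (module form: Mathlib `Module.Flat.of_retract`), in ring-hom currency and up to an
automorphism of the retract: `θ : R → A`, `ψ : R → B` FLAT, `b : A → B` with `b ∘ θ = ψ`, and `ρ : B → A` with `ρ ∘ b` BIJECTIVE
⇒ `θ` is flat (`A` is an `R`-module direct summand of `B` via `b` and `(ρ b)⁻¹ ∘ ρ`; «a direct sum is flat iff each summand is
flat»). [cite: AtiyahMacdonald1969, Ch. 2 Exercise 4 (p. 31)] -/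
theorem ringHom_flat_of_retract {R A B : Type*} [CommRing R] [CommRing A] [CommRing B]
    (θ : R →+* A) (ψ : R →+* B) (b : A →+* B) (ρ : B →+* A)
    (hb : b.comp θ = ψ) (hρ : Function.Bijective (ρ.comp b)) (hψ : ψ.Flat) : θ.Flat := by
  letI := θ.toAlgebra
  letI := ψ.toAlgebra
  haveI : Module.Flat R B := hψ
  let e : A ≃+* A := RingEquiv.ofBijective (ρ.comp b) hρ
  have he : ∀ a, e.symm (ρ (b a)) = a := fun a => e.symm_apply_apply a
  have hbθ : ∀ r : R, b (θ r) = ψ r := fun r => by rw [← hb]; rfl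
  -- `b` as an `R`-linear map `A → B`
  let i : A →ₗ[R] B :=
    { toFun := b
      map_add' := fun x y => map_add b x y
      map_smul' := fun r x => by
        change b (θ r * x) = ψ r * b x
        rw [map_mul, hbθ] }
  -- the retraction `e⁻¹ ∘ ρ` as an `R`-linear map `B → A`
  let q : B →ₗ[R] A :=
    { toFun := fun y => e.symm (ρ y)
      map_add' := fun x y => by rw [map_add, map_add]
      map_smul' := fun r y => by
        change e.symm (ρ (ψ r * y)) = θ r * e.symm (ρ y)
        rw [map_mul, map_mul, ← hbθ, he] }
  have hqi : q.comp i = LinearMap.id := by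
    ext a
    exact he a
  exact Module.Flat.of_retract i q hqi

/-! ## §2 Schemes: a retract over `S` of a flat `S`-scheme is flat -/

/-- **A RETRACT OF A FLAT `S`-SCHEME IS FLAT**: `X → S`, `Y → S`, an `S`-morphism `r : Y → X` (`r ≫ pX = pY`) with a section
`j : X → Y` (`j ≫ r = 𝟙 X`; then automatically `j ≫ pY = pX`); if `Y → S` is flat then so is `X → S`.  Proof stalkwise (Mathlib `Flat.iff_flat_stalkMap`): at `x ∈ X` with `y = j x`, the local
ring `𝒪_{X,x}` is a retract of the flat `𝒪_{S,s}`-algebra `𝒪_{Y,y}` via `r^*_y : 𝒪_{X,x} → 𝒪_{Y,y}` and `j^*_x : 𝒪_{Y,y} → 𝒪_{X,x}`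
(`j^* ∘ r^* = (r ∘ j)^* = 𝟙` up to the canonical identification of stalks), hence flat (§1).  Typical use: the image of an
idempotent endomorphism of a finite flat group scheme. [cite: AtiyahMacdonald1969, Ch. 2 Exercise 4 (p. 31)] -/
theorem flat_of_retract {X Y S : Scheme.{u}} (pX : X ⟶ S) (pY : Y ⟶ S) (j : X ⟶ Y) (r : Y ⟶ X)
    (hr : r ≫ pX = pY) (hjr : j ≫ r = 𝟙 X) [Flat pY] : Flat pX := by
  refine Flat.of_stalkMap _ fun x => ?_
  -- reduce to the point `x' = r (j x)` (equal to `x`)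
  have hx : r (j x) = x := by
    change (j ≫ r) x = x
    rw [hjr]
    rfl
  suffices h : (pX.stalkMap (r (j x))).hom.Flat by rwa [hx] at h
  -- the flat structure map of `𝒪_{Y, j x}`
  have hψ : (pY.stalkMap (j x)).hom.Flat := Flat.stalkMap pY (j x)
  -- `pY^*_{j x} = e₁ ≫ pX^*_{r (j x)} ≫ r^*_{j x}` for an identification of stalks `e₁`
  obtain ⟨e₁, h1⟩ : ∃ e₁ : S.presheaf.stalk (pY (j x)) ≅ S.presheaf.stalk (pX (r (j x))),
      pY.stalkMap (j x) = e₁.hom ≫ pX.stalkMap (r (j x)) ≫ r.stalkMap (j x) := by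
    have h := Scheme.Hom.stalkMap_congr_hom pY (r ≫ pX) hr.symm (j x)
    rw [Scheme.Hom.stalkMap_comp] at h
    exact ⟨_, h⟩
  -- `r^*_{j x} ≫ j^*_x = (j ≫ r)^*_x = e₂` is an identification of stalks
  obtain ⟨e₂, h2⟩ : ∃ e₂ : X.presheaf.stalk (r (j x)) ≅ X.presheaf.stalk x,
      r.stalkMap (j x) ≫ j.stalkMap x = e₂.hom := by
    have h := (Scheme.Hom.stalkMap_comp j r x).symm.trans (Scheme.Hom.stalkMap_congr_hom (j ≫ r) (𝟙 X) hjr x)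
    rw [Scheme.Hom.stalkMap_id] at h
    exact ⟨_, h.trans (Category.comp_id _)⟩
  -- §1 with `θ := e₁ ≫ pX^*`, `ψ := pY^*`, `b := r^*`, `ρ := j^* ≫ e₂⁻¹`
  have hθ : (e₁.hom ≫ pX.stalkMap (r (j x))).hom.Flat := by
    refine ringHom_flat_of_retract _ (pY.stalkMap (j x)).hom (r.stalkMap (j x)).hom (j.stalkMap x ≫ e₂.inv).hom
      ?_ ?_ hψ
    · rw [← CommRingCat.hom_comp, Category.assoc, ← h1]
    · rw [← CommRingCat.hom_comp, ← Category.assoc, h2, Iso.hom_inv_id, CommRingCat.hom_id]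
      exact Function.bijective_id
  rw [CommRingCat.hom_comp] at hθ
  exact (RingHom.Flat.comp_iff_of_bijective_right e₁.commRingCatIsoToRingEquiv.bijective).mp hθ

end Literature.AlgebraicGeometry.Morphisms

end
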